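import Summits.BirchSwinnertonDyer.Rank1Residual.X2.SelmerCotorsionOfFiniteTorsion
import Summits.BirchSwinnertonDyer.Rank1Residual.X2.NonPrimitiveSelmerTorsionCard
import Literature.NumberTheory.EllipticCurves.Greenberg1999.NoProperFiniteIndexSubmoduleOrdinary
import Literature.NumberTheory.EllipticCurves.KatoRankBoundSelmerProofs
import Literature.NumberTheory.EllipticCurves.SelmerCorankProofs
import Mathlib.LinearAlgebra.FreeModule.ModN
import HarnessLib

/-!
# `Sel_{p^∞}(E/ℚ_∞)` is `p`-DIVISIBLE at `μ = 0` from Greenberg's Prop. 4.15 (ii) ("no proper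
# `Λ`-submodule of finite index") — the divisibility half of GV Prop. (2.5)/p. 25 for the CLASSICAL
# Selmer group, from a registered record, plus the algebra that carries it

HONEST FRAMING (BSD rank-`≤ 1` residual cell `b2b-bsdres`, home
`run/shared/lean/b2b/bsd-rank1-residual/`, unit `b2b-bsdres-eisenstein-p2`, class X2 = odd
multiplicative Eisenstein primes; research route, no claim beyond stated classes; nothing booked
here; labels unchanged): the cell deletes the COMBINATION-SHAPED residual classes of the rank-`≤ 1`
BSD formula from PUBLISHED theorems only and TYPES the construction-shaped ones; this is not
"finishing BSD". THEOREMS ONLY (no definition, no named fact, nothing asserted).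

## What (gen 31, programme P2 step 1)

The X2a closure term of record (`ClassClosureDatumFree.targetA_datumFree`, 13 registered facts)
binds the record A135 `GreenbergVatsal2000.datumSelmer_divisible_of_finite_torsionBy` (GV Prop.
(2.5) with p. 25: at `μ = 0` the non-primitive datum Selmer group `S^{Σ₀}_A(ℚ_∞)` is `p`-divisible),
and the A14 chain binds its good-ordinary sibling A116. Greenberg's Prop. 4.15 (ii) (LNM 1716; the
registered record `Greenberg1999.prop415ii_noFiniteSubmodule_of_ordinary_or_multiplicative`, case
`F = ℚ`, `v₀ = p ≥ 3` good ordinary or multiplicative) says that the Pontryagin dual `X(E/ℚ_∞)` of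
the CLASSICAL Selmer group has no nonzero finite `Λ`-submodule. This file turns that record into
DIVISIBILITY of `Sel_{p^∞}(E/ℚ_∞)` at `μ = 0`:

* §1 (pure algebra) `exists_nsmul_eq_of_forall_nsmul_eq_zero`: if a character group
  `X ≅ Hom(S, ℚ/ℤ)` has no `p`-torsion then `S = pS` (a class `s ∉ pS` is detected by a character of
  `S/pS`, Mathlib `CharacterModule.eq_zero_of_character_apply`, which is a nonzero `p`-torsion
  character of `S`); `forall_nsmul_eq_zero_of_noFiniteSubmodule`: a finitely generated torsion
  `Λ`-module with `μ = 0` (hence finitely generated over `ℤ_p`, tree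
  `moduleFinite_int_of_muInvariant_eq_zero`) and no nonzero finite `Λ`-submodule has no `p`-torsion
  (the `Λ`-span of a `p`-torsion element lies in the finite group `X[p]`, tree
  `ZpCorank.finite_torsionBy`); `divisible_of_divisible_quotient`: `T ≤ S` with `T` divisible and
  `S/T` divisible ⇒ `S` divisible.
* §2 **`selmerInfty_divisible_of_prop415ii`**: for `E/ℚ` globally minimal, `p ≥ 3` good ordinary
  or multiplicative, `κ` cyclotomic with topological generator `γ`, a finitely generated torsion
  dual datum `D` with `μ = 0`: `Sel_{p^∞}(E/ℚ_∞) = p · Sel_{p^∞}(E/ℚ_∞)`, granted Prop. 4.15 (ii)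
  (`h415`); `…_of_finite_torsionBy`: the same from `Sel_{p^∞}(E/ℚ_∞)[p]` finite (cotorsion and
  `μ = 0` are then tree theorems: `SelmerCotorsionOfFiniteTorsion`, `MuVanishingOfFiniteModP`).

Consumers (this generation): `X2/DatumSelmerDivisibleDerived` (A135 at every odd multiplicative
prime ⇐ Prop. 4.15 (ii) + T-GV23L + A137′) and `X2/NonPrimitiveSelmerDivisibleGoodOrdinaryDerived`
(A116 ⇐ Prop. 4.15 (ii) + T-GV23L + A111).

References: R. Greenberg, *Iwasawa theory for elliptic curves*, LNM 1716 (1999), Prop. 4.15 (held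
copy chunk p0125), §1 p. 60; R. Greenberg, V. Vatsal, Invent. Math. 142 (2000) =
arXiv:math/9906215, §2 Prop. (2.5) p. 23 and p. 25 ("By Proposition (2.5) its `𝒪`-torsion
submodule is `0`, and so `S^{Σ₀}_A(ℚ_∞)` is `𝒪`-divisible"); Washington §13.2.
-/

noncomputable section

open scoped Classical AddSubgroup

universe u

namespace Summit.BirchSwinnertonDyer.Rank1Residual.X2.SelmerDivisibleOfNoFiniteSubmodule

open Literature.NumberTheory.EllipticCurves WeierstrassCurve
  Summit.BirchSwinnertonDyer.Rank1Residual.X2.NonPrimitiveSelmerTorsionCard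
  Summit.BirchSwinnertonDyer.Rank1Residual.X2.MuVanishingOfFiniteModP
  Summit.BirchSwinnertonDyer.Rank1Residual.X2.MuTransferDerived
  Summit.BirchSwinnertonDyer.Rank1Residual.X2.SelmerCotorsionOfFiniteTorsion

/-! ## §1. Algebra -/

section Algebra

variable (p : ℕ) [hp : Fact p.Prime]

omit hp in
/-- **A character group without `p`-torsion has a `p`-divisible source**: if `X ≅ Hom(S, ℚ/ℤ)` (as
groups) and `p·x = 0 ⇒ x = 0` on `X`, then every `s ∈ S` is `p·t`. (If `s ∉ pS`, its class in
`S/pS` is nonzero, so some character `c` of `S/pS` does not vanish on it; `c ∘ (S → S/pS)` is then a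
nonzero character of `S` killed by `p`.) GV p. 25: "its `𝒪`-torsion submodule is `0`, and so
`S^{Σ₀}_A(ℚ_∞)` is `𝒪`-divisible". [cite: GreenbergVatsal2000, §2 p. 25] -/
theorem exists_nsmul_eq_of_forall_nsmul_eq_zero {S : Type*} [AddCommGroup S] {X : Type*}
    [AddCommGroup X] (Ψ : X ≃+ CharacterModule S) (hX : ∀ x : X, p • x = 0 → x = 0) (s : S) :
    ∃ t : S, p • t = s := by
  by_contra hs
  push Not at hs
  -- the class of `s` in `S/pS` is nonzero
  have hq : ModN.mkQ p s ≠ 0 := by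
    intro h
    have h' : s ∈ LinearMap.range (LinearMap.lsmul ℤ S p) :=
      (Submodule.Quotient.mk_eq_zero _).mp h
    obtain ⟨t, ht⟩ := h'
    refine hs t ?_
    rw [← natCast_zsmul]
    exact ht
  -- a character of `S/pS` detecting it
  obtain ⟨c, hc⟩ : ∃ c : CharacterModule (ModN S p), c (ModN.mkQ p s) ≠ 0 := by
    by_contra h
    push Not at h
    exact hq (CharacterModule.eq_zero_of_character_apply h)
  -- the composite character of `S` is `p`-torsion and nonzero
  let χ : CharacterModule S := AddMonoidHom.comp c (ModN.mkQ p)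
  have hχs : χ s = c (ModN.mkQ p s) := rfl
  have hpχ : p • χ = 0 := by
    refine CharacterModule.ext (A := S) fun t ↦ ?_
    change p • χ t = 0
    rw [← map_nsmul]
    change c (ModN.mkQ p (p • t)) = 0
    have hpt : ModN.mkQ p (p • t) = 0 := by
      refine (Submodule.Quotient.mk_eq_zero _).mpr ⟨t, ?_⟩
      rw [← natCast_zsmul]
      rfl
    rw [hpt, map_zero]
  have hx : Ψ.symm χ = 0 := hX _ (by rw [← map_nsmul, hpχ, map_zero])
  have hχ0 : χ = 0 := by
    have := congrArg Ψ hx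
    rwa [AddEquiv.apply_symm_apply, map_zero] at this
  exact hc (by rw [← hχs, hχ0]; rfl)

/-- **A finitely generated torsion `Λ`-module with `μ = 0` and no nonzero finite `Λ`-submodule has
no `p`-torsion.** At `μ = 0` the module is finitely generated over `ℤ_p`, so `X[p]` is finite
(`ZpCorank.finite_torsionBy`); the `Λ`-span of an element `x` with `p·x = 0` lies in `X[p]`, hence is
a finite `Λ`-submodule, hence `0`. (GV p. 25: "`S^{Σ₀}_A(ℚ_∞)^` would be a finitely generated
`𝒪`-module. By Proposition (2.5) its `𝒪`-torsion submodule is `0`".)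
[cite: GreenbergVatsal2000, §2 p. 25] [cite: GreenbergLNM1716, Prop. 4.15 (ii)] -/
theorem forall_nsmul_eq_zero_of_noFiniteSubmodule (X : Type u) [AddCommGroup X]
    [Module (IwasawaAlgebra p) X] [Module.Finite (IwasawaAlgebra p) X]
    (hX : Module.IsTorsion (IwasawaAlgebra p) X) (hμ : muInvariant p X = 0)
    (hN : ∀ N : Submodule (IwasawaAlgebra p) X, Finite N → N = ⊥) :
    ∀ x : X, p • x = 0 → x = 0 := by
  letI : Module ℤ_[p] X := Module.compHom X (algebraMap ℤ_[p] (IwasawaAlgebra p))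
  haveI : IsScalarTower ℤ_[p] (IwasawaAlgebra p) X := IsScalarTower.of_compHom ℤ_[p] _ X
  haveI : Module.Finite ℤ_[p] X := moduleFinite_int_of_muInvariant_eq_zero p X hX hμ
  haveI hfin : Finite (X[(p : ℤ)]) := ZpCorank.finite_torsionBy p X
  intro x hx
  -- the span of `x` lies in `X[p]`
  have hsub : ∀ y ∈ Submodule.span (IwasawaAlgebra p) ({x} : Set X), y ∈ X[(p : ℤ)] := by
    intro y hy
    obtain ⟨a, rfl⟩ := Submodule.mem_span_singleton.mp hy
    rw [AddSubgroup.torsionBy.nsmul_iff, smul_comm p a x, hx, smul_zero]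
  have hfinN : Finite (Submodule.span (IwasawaAlgebra p) ({x} : Set X)) := by
    refine Finite.of_injective (fun y : Submodule.span (IwasawaAlgebra p) ({x} : Set X) ↦
      (⟨(y : X), hsub y y.2⟩ : X[(p : ℤ)])) fun y y' h ↦ ?_
    exact Subtype.ext (by simpa using h)
  have hbot := hN _ hfinN
  rw [Submodule.span_singleton_eq_bot] at hbot
  exact hbot

end Algebra

section Tower

variable (p : ℕ)

/-- **Divisible-by-divisible is divisible**: for subgroups `T ≤ S` of an abelian group, if `T = pT`
and `S/T` is `p`-divisible (`∀ s ∈ S, ∃ t ∈ S, p·t − s ∈ T`), then `S = pS`. [folklore] -/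
theorem divisible_of_divisible_quotient {G : Type*} [AddCommGroup G] {T S : AddSubgroup G}
    (hTS : T ≤ S) (hT : ∀ s ∈ T, ∃ t ∈ T, p • t = s)
    (hQ : ∀ s ∈ S, ∃ t ∈ S, p • t - s ∈ T) :
    ∀ s ∈ S, ∃ t ∈ S, p • t = s := by
  intro s hs
  obtain ⟨t, ht, hts⟩ := hQ s hs
  obtain ⟨u, hu, hus⟩ := hT _ hts
  refine ⟨t - u, S.sub_mem ht (hTS hu), ?_⟩
  rw [nsmul_sub, hus, sub_sub_cancel]

end Tower

/-! ## §2. `Sel_{p^∞}(E/ℚ_∞)` is divisible at `μ = 0`, from Greenberg's Prop. 4.15 (ii) -/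

section Selmer

variable (W : WeierstrassCurve ℚ) [W.IsElliptic] [W.IsGloballyMinimal] (p : ℕ) [hp : Fact p.Prime]
  {κ : ZpExtension ℚ p} {γ : Field.absoluteGaloisGroup ℚ}

/-- **`Sel_{p^∞}(E/ℚ_∞) = p · Sel_{p^∞}(E/ℚ_∞)` at `μ = 0`, from Greenberg's Prop. 4.15 (ii).** For
`E/ℚ` globally minimal, `p ≥ 3` of good ordinary or multiplicative reduction, `κ` the cyclotomic
`ℤ_p`-extension with topological generator `γ`, and a finitely generated `Λ`-torsion Pontryagin-dual
datum `D` with `μ(D.X) = 0`: the registered record `h415` ("`Sel_E(ℚ_∞)_p` has no proper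
`Λ`-submodules of finite index", dual currency) makes `D.X` `p`-torsion-free (§1), and Pontryagin
duality turns that into divisibility of the Selmer group. This is GV's p. 25 step "By Proposition
(2.5) its `𝒪`-torsion submodule is `0`, and so … is `𝒪`-divisible" for the CLASSICAL group, with
GV's Prop. (2.5) replaced by Greenberg's Prop. 4.15 (ii).
[cite: GreenbergLNM1716, Prop. 4.15 (ii) (held copy chunk p0125 L22–28)]
[cite: GreenbergVatsal2000, §2 Prop. (2.5) p. 23, p. 25] -/
theorem selmerInfty_divisible_of_prop415ii
    (h415 : Greenberg1999.prop415ii_noFiniteSubmodule_of_ordinary_or_multiplicative)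
    (hp3 : 3 ≤ p) (hred : IsOrdinaryAt W p ∨ W.HasMultiplicativeReductionAtPrime p)
    (hκ : κ.IsCyclotomic) (hγ : κ.IsTopGenerator γ) (D : W.SelmerDualData κ γ)
    [Module.Finite (IwasawaAlgebra p) D.X] (hX : D.IsTorsion) (hμ : D.mu = 0) :
    ∀ s ∈ W.selmerInfty κ, ∃ t ∈ W.selmerInfty κ, p • t = s := by
  have hN : ∀ N : Submodule (IwasawaAlgebra p) D.X, Finite N → N = ⊥ :=
    fun N hN ↦ h415 W p hp3 hred κ γ hκ hγ D hX N hN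
  have hX' := forall_nsmul_eq_zero_of_noFiniteSubmodule p D.X hX hμ hN
  intro s hs
  obtain ⟨t, ht⟩ := exists_nsmul_eq_of_forall_nsmul_eq_zero p
    (AddEquiv.ofBijective D.toDual D.bijective) hX' ⟨s, hs⟩
  exact ⟨t, t.2, by rw [← AddSubgroupClass.coe_nsmul, ht]⟩

/-- **`Sel_{p^∞}(E/ℚ_∞)` is divisible when `Sel_{p^∞}(E/ℚ_∞)[p]` is finite**, from Prop. 4.15 (ii):
finiteness of the `p`-torsion makes the canonical dual `X(E/ℚ_∞)` finitely generated
(`SelmerDualData.module_finite_of_isCyclotomic`), `Λ`-torsion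
(`isTorsion_and_exists_hasUnitContent_of_finite_torsionBy`) with `μ = 0`
(`muInvariant_eq_zero_of_finite_modN'`, `X/pX ↪ Hom(Sel[p], ℚ/ℤ)`), and the previous theorem
applies. GV p. 25: "`S_A(ℚ_∞)` is `Λ`-cotorsion and has `μ`-invariant `0` if and only if
`S_A(ℚ_∞)[π]` is finite". [cite: GreenbergLNM1716, Prop. 4.15 (ii)]
[cite: GreenbergVatsal2000, §2 p. 25] -/
theorem selmerInfty_divisible_of_prop415ii_of_finite_torsionBy
    (h415 : Greenberg1999.prop415ii_noFiniteSubmodule_of_ordinary_or_multiplicative)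
    (hp3 : 3 ≤ p) (hred : IsOrdinaryAt W p ∨ W.HasMultiplicativeReductionAtPrime p)
    (hκ : κ.IsCyclotomic) (hγ : κ.IsTopGenerator γ) [Finite ((↥(W.selmerInfty κ))[(p : ℤ)])] :
    ∀ s ∈ W.selmerInfty κ, ∃ t ∈ W.selmerInfty κ, p • t = s := by
  let D : W.SelmerDualData κ γ := W.selmerDualData κ hγ
  haveI : Module.Finite (IwasawaAlgebra p) D.X :=
    SelmerDualData.module_finite_of_isCyclotomic (W := W) (κ := κ) hκ D hγ
  have hX : D.IsTorsion := (isTorsion_and_exists_hasUnitContent_of_finite_torsionBy W hκ hγ D).1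
  haveI : Finite (ModN (CharacterModule (W.selmerInfty κ)) p) :=
    finite_modN_characterModule_of_finite_torsionBy p
  let e : D.X ≃+ CharacterModule (W.selmerInfty κ) := AddEquiv.ofBijective D.toDual D.bijective
  haveI hfin : Finite (ModN D.X p) := Finite.of_equiv _ (modNEquiv e p).symm.toEquiv
  have hμ : D.mu = 0 := muInvariant_eq_zero_of_finite_modN' p D.X hX hfin
  exact selmerInfty_divisible_of_prop415ii W p h415 hp3 hred hκ hγ D hX hμ

end Selmer

end Summit.BirchSwinnertonDyer.Rank1Residual.X2.SelmerDivisibleOfNoFiniteSubmodule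

end
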